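import Summits.BirchSwinnertonDyer.BirchSwinnertonDyer.Theorems.BiquadraticEisensteinDescentHeegnerTwistCouplingInSupplyLinnikCensusKTwo
import HarnessLib

set_option linter.dupNamespace false -- `Summit.BirchSwinnertonDyer.BirchSwinnertonDyer.Theorems.…` (summit = sub)
set_option autoImplicit false

/-!
# Crux `HeegnerTwistCouplingInSupply` (stmt-BirchSwinnertonDyer-21381) — the pattern-free census at `k = 2`, EVEN base:
# scalar specialisation and `E_{42p}` for all but `O(log⁸Q)` primes `p ≡ 3 (mod 4)`

Route `BiquadraticEisensteinDescent` (cell `pub/bsd-wall`, width seat `bsd-wall-cm-bed-w3` g20; `--supports` 21381, helper). Companion of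
`…LinnikCensusK` / `…LinnikCensusKTwo`: the EVEN census `kAny_allBut_even_of_BT` specialised to scalars at `k = 2`
(`kTwo_allBut_two_even_of_BT`) and its first instance, the even three-prime congruent family `W = E_{42p} = E_{2·3·7·p}`, whose root
number is `−1` for EVERY `p ≡ 3 (mod 4)` — so the census covers both CM-inert classes `p ≡ 3, 7 (mod 8)` at once (two `assemble_four`).

* ★ `kTwo_allBut_two_even_of_BT`;
* ★ `cruxConclusion_E42p_allBut_of_BT` — for all but `O(log⁸ Q)` primes `p ≡ 3 (mod 4)` in `(√Q, Q]`: a Heegner field `K′` of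
  `N(E_{42p})` with `4 < |d_{K′}|`, `L(E_{42p}^{(d_{K′})}, 1) ≠ 0`, `p ∤ h(K′)` — modulo Burungale–Tian ONLY.

HONEST FRAMING: RUNG-LEVEL, density one in `p` with a polylog exceptional set, one more congruent family; the crux as stated (all CM
`W`, all `p ≥ 5`; residual C⁺), its registered stubs and BSD are NOT touched; nothing is closed. THEOREMS ONLY.
-/

namespace Summit.BirchSwinnertonDyer.BirchSwinnertonDyer.Theorems.LinnikCensus

open Finset
open Literature.NumberTheory.EllipticCurves
open Summit.BirchSwinnertonDyer.BirchSwinnertonDyer.Theorems.SymbolicMonsky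

/-! ## The `k = 2`, two-slot specialisation, EVEN base -/

open scoped Classical in
/-- ★ **k = 2, two slots, EVEN base `W = E_{2p r₁ r₂}`** — `kAny_allBut_even_of_BT` with all data as scalars: base classes `pc, rc₁, rc₂`,
base symbols `a = [(r₁/p) = −1]`, `b = [(r₂/p) = −1]`, `r12 = [(r₂/r₁) = −1]`; cells `(c₀, m₀), (c₁, m₁)` (class index, bitmask
`bit 0 = [(q/p) = −1]`, `bit 1 = [(q/r₁) = −1]`, `bit 2 = [(q/r₂) = −1]`, bits `1, 2` also passed as Booleans `e…` for the slot
obligations); unit slot classes `κ₀, κ₁ (mod 8 r₁ r₂)`. The pattern-free check `hpf` is ONE `decide`. Modulo Burungale–Tian ONLY. [cite: BurungaleTian2026, Thm. 1.1] [cite: Montgomery1978, p. 561]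
[cite: MontgomeryVaughan2007, Cor. 11.17] -/
theorem kTwo_allBut_two_even_of_BT (hBT : burungaleTian_analyticRank_eq_zero_of_selmerCorank_eq_zero_of_hasCM)
    (pc rc₁ rc₂ : Fin 4) (r12 a b : Bool) (c₀ c₁ : Fin 4) (m₀ m₁ : ℕ)
    (hpf : pfRecipeEven (⟨![pc, rc₁, rc₂], ![![false, a, b], ![false, false, r12], ![false, false, false]]⟩ : SymbData 3)
      [(c₀, m₀), (c₁, m₁)] = true)
    (hdist : c₀ ≠ c₁ ∨ m₀.testBit 0 ≠ m₁.testBit 0 ∨ m₀.testBit 1 ≠ m₁.testBit 1 ∨ m₀.testBit 2 ≠ m₁.testBit 2)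
    {r₁ r₂ : ℕ} (hr₁ : r₁.Prime) (hr₂ : r₂.Prime) (hne : r₁ ≠ r₂) (hr₁m : r₁ % 8 = clsVal rc₁) (hr₂m : r₂ % 8 = clsVal rc₂)
    (hr12 : jacobiSym (r₂ : ℤ) r₁ = -1 ↔ r12 = true)
    (κ₀ κ₁ : ℕ) (hκ₀u : IsUnit ((κ₀ : ℕ) : ZMod (8 * (r₁ * r₂)))) (hκ₁u : IsUnit ((κ₁ : ℕ) : ZMod (8 * (r₁ * r₂))))
    (hκ₀m : κ₀ % 8 = clsVal c₀) (hκ₁m : κ₁ % 8 = clsVal c₁)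
    (e₀₁ e₀₂ e₁₁ e₁₂ : Bool) (hb₀₁ : m₀.testBit 1 = e₀₁) (hb₀₂ : m₀.testBit 2 = e₀₂) (hb₁₁ : m₁.testBit 1 = e₁₁)
    (hb₁₂ : m₁.testBit 2 = e₁₂)
    (hκ₀e : ∀ q : ℕ, q.Prime → q % (8 * (r₁ * r₂)) = κ₀ % (8 * (r₁ * r₂)) →
      (jacobiSym (q : ℤ) r₁ = -1 ↔ e₀₁ = true) ∧ (jacobiSym (q : ℤ) r₂ = -1 ↔ e₀₂ = true))
    (hκ₁e : ∀ q : ℕ, q.Prime → q % (8 * (r₁ * r₂)) = κ₁ % (8 * (r₁ * r₂)) →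
      (jacobiSym (q : ℤ) r₁ = -1 ↔ e₁₁ = true) ∧ (jacobiSym (q : ℤ) r₂ = -1 ↔ e₁₂ = true)) :
    ∃ C : ℝ, 0 < C ∧ ∀ Q : ℕ, 3 ≤ Q → ∃ E : Finset ℕ, (E.card : ℝ) ≤ C * Real.log Q ^ 8 ∧
      ∀ p : ℕ, p.Prime → p % 8 = clsVal pc → (jacobiSym (r₁ : ℤ) p = -1 ↔ a = true) → (jacobiSym (r₂ : ℤ) p = -1 ↔ b = true) →
        Nat.sqrt Q < p → p ≤ Q → p ∉ E →
        ∃ (K : Type) (_ : Field K) (_ : NumberField K),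
          IsImaginaryQuadratic K ∧ 4 < (NumberField.discr K).natAbs ∧
          SatisfiesHeegnerHypothesis ((congruentNumberCurve (2 * (p * (r₁ * r₂)))).conductorNorm ℤ) K ∧
          ((congruentNumberCurve (2 * (p * (r₁ * r₂)))).quadraticTwist (NumberField.discr K : ℚ)).entireLFunction 1 ≠ 0 ∧
          ¬ p ∣ NumberField.classNumber K := by
  have hr : ∀ j : Fin 2, ((![r₁, r₂] : Fin 2 → ℕ) j).Prime := by
    intro j; fin_cases j
    · exact hr₁
    · exact hr₂
  have hrinj : Function.Injective (![r₁, r₂] : Fin 2 → ℕ) := by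
    intro i j h
    fin_cases i <;> fin_cases j
    · rfl
    · exact absurd h hne
    · exact absurd h.symm hne
    · rfl
  have hM : 8 * (r₁ * r₂) = 8 * ∏ j, (![r₁, r₂] : Fin 2 → ℕ) j := by simp [Fin.prod_univ_two]
  have hprod : ∀ p : ℕ, p * ∏ j, (![r₁, r₂] : Fin 2 → ℕ) j = p * (r₁ * r₂) := by
    intro p; simp [Fin.prod_univ_two]
  have hκ : ∀ i : Fin [(c₀, m₀), (c₁, m₁)].length, i = ⟨0, by simp⟩ ∨ i = ⟨1, by simp⟩ := by
    rintro ⟨i, hi⟩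
    have : i < 2 := by simpa using hi
    interval_cases i
    · left; rfl
    · right; rfl
  obtain ⟨C, hC, h⟩ := kAny_allBut_even_of_BT hBT
    (⟨![pc, rc₁, rc₂], ![![false, a, b], ![false, false, r12], ![false, false, false]]⟩ : SymbData 3) [(c₀, m₀), (c₁, m₁)] hpf
    (by simp) (by
      intro i j hij
      rcases hκ i with rfl | rfl <;> rcases hκ j with rfl | rfl
      · exact absurd rfl hij
      · rcases hdist with h | h | h | h
        · exact Or.inl h
        · exact Or.inr ⟨0, h⟩
        · exact Or.inr ⟨1, h⟩
        · exact Or.inr ⟨2, h⟩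
      · rcases hdist with h | h | h | h
        · exact Or.inl fun hh => h hh.symm
        · exact Or.inr ⟨0, fun hh => h hh.symm⟩
        · exact Or.inr ⟨1, fun hh => h hh.symm⟩
        · exact Or.inr ⟨2, fun hh => h hh.symm⟩
      · exact absurd rfl hij)
    ![r₁, r₂] hr (by
      intro j; fin_cases j
      · simpa using hr₁m
      · simpa using hr₂m) hrinj (by
      intro i j hij
      fin_cases i <;> fin_cases j
      · exact absurd hij (lt_irrefl _)
      · simpa using hr12
      · exact absurd hij (by decide)
      · exact absurd hij (lt_irrefl _))
    hM (fun i => if i.val = 0 then κ₀ else κ₁) (by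
      intro i; rcases hκ i with rfl | rfl
      · simpa using hκ₀u
      · simpa using hκ₁u)
    (by
      intro i; rcases hκ i with rfl | rfl
      · simpa using hκ₀m
      · simpa using hκ₁m)
    (by
      intro i q hq hqκ j
      rcases hκ i with rfl | rfl
      · have hh := hκ₀e q hq (by simpa using hqκ)
        fin_cases j
        · have hh1 := hh.1; rw [← hb₀₁] at hh1; simpa using hh1
        · have hh2 := hh.2; rw [← hb₀₂] at hh2; simpa using hh2
      · have hh := hκ₁e q hq (by simpa using hqκ)
        fin_cases j
        · have hh1 := hh.1; rw [← hb₁₁] at hh1; simpa using hh1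
        · have hh2 := hh.2; rw [← hb₁₂] at hh2; simpa using hh2)
  refine ⟨C, hC, fun Q hQ => ?_⟩
  obtain ⟨E, hE, hp⟩ := h Q hQ
  refine ⟨E, hE, fun p hp' hp8 ha hb hyp hpQ hpE => ?_⟩
  rw [← hprod p]
  exact hp p hp' (by simpa using hp8) (by
    intro j; fin_cases j
    · simpa using ha
    · simpa using hb) hyp hpQ hpE


/-! ## `W = E_{42p}`, every `p ≡ 3 (mod 4)` — the first EVEN three-prime congruent family -/

open scoped Classical in
/-- ★ **`E_{42p}` (k = 2, even base `2·3·7·p`): the conclusion of crux 21381 for all but `O(log⁸ Q)` primes `p ≡ 3 (mod 4)` in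
`(√Q, Q]`, modulo Burungale–Tian** — both CM-inert classes `p ≡ 3, 7 (mod 8)` (root number `−1` for every `p ≡ 3 (4)` since
`42p ≡ 6 (8)`). Base `(p, 3, 7)`, `(7/3) = +1`; four pattern-free families over the eight sub-configurations (criterion, ONE `decide`
each, `t = 2`), slot classes modulo `168`: `(43, 5)`, `(19, 29)` (with two sign assignments), `(59, 37)`.
[cite: BurungaleTian2026, Thm. 1.1] [cite: Montgomery1978, p. 561] [cite: MontgomeryVaughan2007, Cor. 11.17] -/
theorem cruxConclusion_E42p_allBut_of_BT (hBT : burungaleTian_analyticRank_eq_zero_of_selmerCorank_eq_zero_of_hasCM) :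
    ∃ C : ℝ, 0 < C ∧ ∀ Q : ℕ, 3 ≤ Q → ∃ E : Finset ℕ, (E.card : ℝ) ≤ C * Real.log Q ^ 8 ∧
      ∀ p : ℕ, p.Prime → p % 4 = 3 → Nat.sqrt Q < p → p ≤ Q → p ∉ E →
        ∃ (K : Type) (_ : Field K) (_ : NumberField K),
          IsImaginaryQuadratic K ∧ 4 < (NumberField.discr K).natAbs ∧
          SatisfiesHeegnerHypothesis ((congruentNumberCurve (42 * p)).conductorNorm ℤ) K ∧
          ((congruentNumberCurve (42 * p)).quadraticTwist (NumberField.discr K : ℚ)).entireLFunction 1 ≠ 0 ∧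
          ¬ p ∣ NumberField.classNumber K := by
  have e : ∀ p : ℕ, 2 * (p * (3 * 7)) = 42 * p := fun p => by ring
  have u : ∀ n : ℕ, Nat.Coprime n 168 → IsUnit ((n : ℕ) : ZMod (8 * (3 * 7))) := fun n hn =>
    (ZMod.isUnit_iff_coprime n (8 * (3 * 7))).mpr hn
  have sl : ∀ {q κ : ℕ}, q % (8 * (3 * 7)) = κ % (8 * (3 * 7)) →
      jacobiSym (q : ℤ) 3 = jacobiSym ((κ % 3 : ℕ) : ℤ) 3 ∧ jacobiSym (q : ℤ) 7 = jacobiSym ((κ % 7 : ℕ) : ℤ) 7 :=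
    fun hq => ⟨jacobiSym_three_of_mod (mod_eq_of_mod_eq_of_dvd (by norm_num) hq),
      jacobiSym_seven_of_mod (mod_eq_of_mod_eq_of_dvd (by norm_num) hq)⟩
  have h7 : Nat.Prime 7 := by norm_num
  have cls3 := assemble_four (pc8 := 3) (R := fun p => ∃ (K : Type) (_ : Field K) (_ : NumberField K),
      IsImaginaryQuadratic K ∧ 4 < (NumberField.discr K).natAbs ∧
      SatisfiesHeegnerHypothesis ((congruentNumberCurve (42 * p)).conductorNorm ℤ) K ∧
      ((congruentNumberCurve (42 * p)).quadraticTwist (NumberField.discr K : ℚ)).entireLFunction 1 ≠ 0 ∧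
      ¬ p ∣ NumberField.classNumber K) Nat.prime_three h7 (fun a b => by
    simp only [← e]
    cases a <;> cases b
    · exact kTwo_allBut_two_even_of_BT hBT 1 1 3 false false false 1 2 0 7 (by decide) (by decide) Nat.prime_three h7
        (by norm_num) rfl rfl (by norm_num) 43 5 (u 43 (by norm_num)) (u 5 (by norm_num)) rfl rfl false false true true
        (by decide) (by decide) (by decide) (by decide)
        (fun q _ hq => by obtain ⟨h3, h7'⟩ := sl hq; rw [h3, h7']; norm_num)
        (fun q _ hq => by obtain ⟨h3, h7'⟩ := sl hq; rw [h3, h7']; norm_num)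
    · exact kTwo_allBut_two_even_of_BT hBT 1 1 3 false false true 1 2 0 7 (by decide) (by decide) Nat.prime_three h7
        (by norm_num) rfl rfl (by norm_num) 43 5 (u 43 (by norm_num)) (u 5 (by norm_num)) rfl rfl false false true true
        (by decide) (by decide) (by decide) (by decide)
        (fun q _ hq => by obtain ⟨h3, h7'⟩ := sl hq; rw [h3, h7']; norm_num)
        (fun q _ hq => by obtain ⟨h3, h7'⟩ := sl hq; rw [h3, h7']; norm_num)
    · exact kTwo_allBut_two_even_of_BT hBT 1 1 3 false true false 1 2 0 7 (by decide) (by decide) Nat.prime_three h7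
        (by norm_num) rfl rfl (by norm_num) 43 5 (u 43 (by norm_num)) (u 5 (by norm_num)) rfl rfl false false true true
        (by decide) (by decide) (by decide) (by decide)
        (fun q _ hq => by obtain ⟨h3, h7'⟩ := sl hq; rw [h3, h7']; norm_num)
        (fun q _ hq => by obtain ⟨h3, h7'⟩ := sl hq; rw [h3, h7']; norm_num)
    · exact kTwo_allBut_two_even_of_BT hBT 1 1 3 false true true 1 2 4 3 (by decide) (by decide) Nat.prime_three h7
        (by norm_num) rfl rfl (by norm_num) 19 29 (u 19 (by norm_num)) (u 29 (by norm_num)) rfl rfl false true true false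
        (by decide) (by decide) (by decide) (by decide)
        (fun q _ hq => by obtain ⟨h3, h7'⟩ := sl hq; rw [h3, h7']; norm_num)
        (fun q _ hq => by obtain ⟨h3, h7'⟩ := sl hq; rw [h3, h7']; norm_num))
  have cls7 := assemble_four (pc8 := 7) (R := fun p => ∃ (K : Type) (_ : Field K) (_ : NumberField K),
      IsImaginaryQuadratic K ∧ 4 < (NumberField.discr K).natAbs ∧
      SatisfiesHeegnerHypothesis ((congruentNumberCurve (42 * p)).conductorNorm ℤ) K ∧
      ((congruentNumberCurve (42 * p)).quadraticTwist (NumberField.discr K : ℚ)).entireLFunction 1 ≠ 0 ∧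
      ¬ p ∣ NumberField.classNumber K) Nat.prime_three h7 (fun a b => by
    simp only [← e]
    cases a <;> cases b
    · exact kTwo_allBut_two_even_of_BT hBT 3 1 3 false false false 1 2 0 7 (by decide) (by decide) Nat.prime_three h7
        (by norm_num) rfl rfl (by norm_num) 43 5 (u 43 (by norm_num)) (u 5 (by norm_num)) rfl rfl false false true true
        (by decide) (by decide) (by decide) (by decide)
        (fun q _ hq => by obtain ⟨h3, h7'⟩ := sl hq; rw [h3, h7']; norm_num)
        (fun q _ hq => by obtain ⟨h3, h7'⟩ := sl hq; rw [h3, h7']; norm_num)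
    · exact kTwo_allBut_two_even_of_BT hBT 3 1 3 false false true 1 2 5 2 (by decide) (by decide) Nat.prime_three h7
        (by norm_num) rfl rfl (by norm_num) 19 29 (u 19 (by norm_num)) (u 29 (by norm_num)) rfl rfl false true true false
        (by decide) (by decide) (by decide) (by decide)
        (fun q _ hq => by obtain ⟨h3, h7'⟩ := sl hq; rw [h3, h7']; norm_num)
        (fun q _ hq => by obtain ⟨h3, h7'⟩ := sl hq; rw [h3, h7']; norm_num)
    · exact kTwo_allBut_two_even_of_BT hBT 3 1 3 false true false 1 2 6 1 (by decide) (by decide) Nat.prime_three h7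
        (by norm_num) rfl rfl (by norm_num) 59 37 (u 59 (by norm_num)) (u 37 (by norm_num)) rfl rfl true true false false
        (by decide) (by decide) (by decide) (by decide)
        (fun q _ hq => by obtain ⟨h3, h7'⟩ := sl hq; rw [h3, h7']; norm_num)
        (fun q _ hq => by obtain ⟨h3, h7'⟩ := sl hq; rw [h3, h7']; norm_num)
    · exact kTwo_allBut_two_even_of_BT hBT 3 1 3 false true true 1 2 6 1 (by decide) (by decide) Nat.prime_three h7
        (by norm_num) rfl rfl (by norm_num) 59 37 (u 59 (by norm_num)) (u 37 (by norm_num)) rfl rfl true true false false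
        (by decide) (by decide) (by decide) (by decide)
        (fun q _ hq => by obtain ⟨h3, h7'⟩ := sl hq; rw [h3, h7']; norm_num)
        (fun q _ hq => by obtain ⟨h3, h7'⟩ := sl hq; rw [h3, h7']; norm_num))
  -- combine the two classes
  obtain ⟨C₃, hC₃, h₃⟩ := cls3
  obtain ⟨C₇, hC₇, h₇⟩ := cls7
  refine ⟨C₃ + C₇, by positivity, fun Q hQ => ?_⟩
  obtain ⟨E₃, hE₃, hp₃⟩ := h₃ Q hQ
  obtain ⟨E₇, hE₇, hp₇⟩ := h₇ Q hQ
  refine ⟨E₃ ∪ E₇, ?_, fun p hp hp4 hyp hpQ hpE => ?_⟩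
  · calc ((E₃ ∪ E₇).card : ℝ) ≤ (E₃.card : ℝ) + E₇.card := by exact_mod_cast Finset.card_union_le E₃ E₇
      _ ≤ C₃ * Real.log Q ^ 8 + C₇ * Real.log Q ^ 8 := add_le_add hE₃ hE₇
      _ = (C₃ + C₇) * Real.log Q ^ 8 := by ring
  · rw [Finset.mem_union, not_or] at hpE
    have h8 : p % 8 = 3 ∨ p % 8 = 7 := by omega
    rcases h8 with h8 | h8
    · exact hp₃ p hp h8 hyp hpQ hpE.1
    · exact hp₇ p hp h8 hyp hpQ hpE.2

end Summit.BirchSwinnertonDyer.BirchSwinnertonDyer.Theorems.LinnikCensus
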